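import Summits.QuantumFields.YangMills.Theorems.UnitScaleTiltProp7ColumnRowsOfKernelDecay
import Summits.QuantumFields.YangMills.Theorems.UnitScaleTiltProp7SectET3GaugeProjectorT3
import HarnessLib

/-!
# Route `UnitScaleTilt`, crux «MinimiserStabilityRegPr» (stmt-QuantumFields-19200), stub `stub_existenceMinimalOrbit` (EX), route (α) — DOOR «OPROW-349»:
# THE DISPLAYED OPERATOR ROW `hOp349` OF S22ᴸ (✓`Prop7StubEXOfChartPiecesTwS22L`: «`DPD*` is a bounded operator», sup→sup on the fine bonds, `P = 1 − R_S`)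
# FROM PRINT'S POINTWISE KERNEL ROW (3.49) — `|(DPD*)_{μν}(x, x′)| ≤ O(1)·e^{−δ·d(y,y′)}` for `x ∈ Δ(y)`, `x′ ∈ Δ(y′)` ([Balaban1985BackgroundPropagators] p.399, the level factors
# `(Lʲη)` being `1` at the one-level member) — by Schur's row sum and the coarse-torus geometric series (★px6 g5 ✓`Prop7ColumnRowsOfKernelDecay.sum_bond_exp_neg_tdist_block_le`)

Cell `ym3-torus`, width seat `ym3-torus-px5` (gen 4; FILL-TO-CAP «width 5»); EX namer ★ym-ust-19200-w2 g8 WORD (2) 2026-08-29T03:11:01Z «px5: OPROW-349 GO»; LOCATE memo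
`HOME/ym3-torus-px5/g4/LOCATE-OPROW-SOCKET-px5g4.md` (19200 evidence #56) §V3.  THEOREMS ONLY (0 `def`, 0 `sorry`); `--supports stmt-QuantumFields-19200 --as helper`; count-neutral.
YM₃ on T³ is ladder rung R3, NOT the Clay problem; nothing here is a claim about the stub, the crux, d = 4 or the mass gap; NOTHING of [Balaban1985BackgroundPropagators] (3.49) is asserted —
the pointwise kernel row `h349` is a DISPLAYED hypothesis (N06 class, print's sentence with locator), this file only INTEGRATES it.

THE PRINT.  [Balaban1985BackgroundPropagators] p. 399: *«For the operator P = I − R we obtain, using again Lemma 2.1, |P(x,x′)|, |(DP)_μ(x,x′)|, |(PD*)_ν(x,x′)|, |(DPD*)_{μν}(x,x′)| ≦ O(1)[…]e^{−δ…}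
for x ∈ Δ(y), y ∈ Λ_j, x′ ∈ Δ(y′), y′ ∈ Λ_{j′}. (3.49)»*; [Balaban1985Variational] p. 299 l. 13 *«the fact that DPD* is a bounded operator»*.  Print's kernel convention is
`(Tλ)(x) = Σ_{x′} η^d T(x,x′) λ(x′)` ((3.11) p.392), so the matrix entry of `T` between two fine bonds carries `η³ = (L^{K−n})⁻³` — the factor that makes the row sum over the `3·L^{3(K−n)}`
fine bonds of each coarse block `K`-uniform.  CURRENCY NOTE (LOCATE §V2, adopted by the EX namer 03:11:01Z): lit NE9's L²-BLOCK-DECAY letters for `D_U(1−R(U))`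
(✓`B9Eq349DPBlockDecayLetters.norm_bondBlock_comp_DP_comp_block_le`) bound an entry by the block norm and are short of this row by exactly `η³`; the POINTWISE (3.49) discharges it.

WHAT IS PROVED (ns `…Theorems.Prop7Op349OfKernelRow`; member `F`, `n ≤ K`, weights `c₀ cB`, background `U₀`; `T_{U₀} X := toL2⁻¹(D_{U₀}(1 − R_S(U₀))D*_{U₀}(toL2 X))`).
* §1 ★ `sum_pbond_exp_neg_tdist_block_le` (★px6's counting fact re-indexed to the route's bonds) and ★★ `sup_row_of_kernel_row` — THE GENERIC SCHUR STEP at a member: for an ADDITIVE map `T`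
  on the fine one-forms, a pointwise kernel bound `‖T(δ_b Z)(bd)‖ ≤ C·(L^{K−n})⁻³·e^{−a·tdist(B^{K−n}(b), B^{K−n}(bd))}·‖Z‖` (`C ≥ 0`, `a > 0`) gives the sup row `‖T X bd‖ ≤ 3C(2(1+1∕a))³·s`
  whenever `‖X b‖ ≤ s` (linearity over `X = Σ_b Pi.single b (X b)`, triangle inequality, row sum).
* §2 ★★★ `hOp349_of_kernel349_family` — S22ᴸ's binder `hOp349` TOKEN FOR TOKEN with `k349 L := 3·C349 L·(2(1 + 1∕δ349 L))³`, from the displayed-to-be family row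
  `h349 : ∀ L>1 i U₀, RegPr (α L) U₀ → ∀ b Z bd, ‖toL2⁻¹(DL2 U₀ (DstarL2 U₀ (toL2 (Pi.single b Z)) − R_S U₀ (DstarL2 U₀ (toL2 (Pi.single b Z))))) bd‖ ≤ C349 L·((L:ℝ)^(K−n))⁻¹^3·
  exp(−δ349 L·tdist(B^{K−n}(b), B^{K−n}(bd)))·‖Z‖` ((3.49) VERBATIM at the member; constants `C349 δ349 : ℕ → ℝ` L-only, `K`-uniform; distance = the coarse-block ℓ¹ torus distance of
  ★px6's column doors); ★ `k349_nonneg` (the display's `hk` conjunct `0 ≤ k349 L` at this letter).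
HONEST SCOPE.  Linearity + triangle inequality + ★px6's counting lemma; no analysis.  FLAT-MEMBER CERTIFICATE of `h349` (named, not typed): at `U₀ = 1`, `R_S(1)` is the flat projector of
✓`Prop7FlatProjectorSeam`∕✓`Prop7LaplaceAFlatCoercive` and the kernel of `∂(1 − R)∂*` is explicit by Fourier — lit ✓`B9Eq349FlatDPBlockDecay`∕`B9Eq349FlatPBlockDecay` (block form),
`B9Thm311FlatKernelZdPer`-class (pointwise); not by `exact` tonight.  Nothing of Thm 3.11, EX, the crux; nothing continuum ∕ OS ∕ mass-gap ∕ Clay.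

References: T. Bałaban, CMP **99** (1985) 389–434 [Balaban1985BackgroundPropagators] ((3.11) p.392, (3.21)–(3.26) pp.394–395, (3.49) p.399); CMP **102** (1985) 277–309
[Balaban1985Variational] (p.299); CMP **96** (1984) 223–250 [Balaban1984PropagatorsII] ((2.61) p.234).
-/

set_option autoImplicit false

noncomputable section

open scoped Matrix.Norms.L2Operator BigOperators InnerProductSpace ComplexConjugate

namespace Summit.QuantumFields.YangMills.Theorems.Prop7Op349OfKernelRow

open Literature.MathematicalPhysics.QuantumFieldTheory.Balaban1983to89
open Literature.MathematicalPhysics.QuantumFieldTheory.Balaban1983to89.T3ContinuumYM3Torus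
open Literature.MathematicalPhysics.QuantumFieldTheory.Balaban1983to89.T3Thm1Carrier
open T3PrintedRegularMinimiser (RegPr)
open B5Eq118OneStroke (iterBlockOf)
open B11Eq103H1Complex (BondL2K)
open Summit.QuantumFields.YangMills.Theorems.Prop7SectET3Transport (periodsT3 bondEquiv)
open Summit.QuantumFields.YangMills.Theorems.Prop7SectET3HilbertLetters (W₂ toL2 DL2 DstarL2)
open Summit.QuantumFields.YangMills.Theorems.Prop7SectET3GaugeProjector (RS)
open Summit.QuantumFields.YangMills.Theorems.Prop7ColumnRowsOfKernelDecay (sum_bond_exp_neg_tdist_block_le)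

/-! ## §1 The generic Schur step at a member: a pointwise `(3.49)`-type kernel row gives the sup row -/

section Schur

variable (F : T3Family) (n K : ℕ)

/-- ★ **THE COUNTING FACT IN THE ROUTE'S BOND LETTERS**: `Σ_{b : PBond (F.P K) 0} e^{−a·tdist(B^{K−n}(b), ŷ)} ≤ 3·(2(1+1∕a))³·(L^{K−n})³` (★px6's ✓`sum_bond_exp_neg_tdist_block_le`
re-indexed along `bondEquiv`). [cite: Balaban1984PropagatorsII, (2.61) p.234] -/
theorem sum_pbond_exp_neg_tdist_block_le (yc : Site (F.P K) (K - n)) {a : ℝ} (ha : 0 < a) :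
    ∑ b : PBond (F.P K) 0, Real.exp (-(a * (Site.tdist (iterBlockOf (K - n) b.src) yc : ℝ)))
      ≤ 3 * (2 * (1 + 1 / a)) ^ 3 * ((F.L : ℝ) ^ (K - n)) ^ 3 := by
  rw [← (bondEquiv F K).symm.sum_comp (fun b : PBond (F.P K) 0 => Real.exp (-(a * (Site.tdist (iterBlockOf (K - n) b.src) yc : ℝ))))]
  exact sum_bond_exp_neg_tdist_block_le F n K yc ha

variable {F n K}

/-- ★★ **THE GENERIC SCHUR STEP**: for a map `T` on the fine one-forms which is ADDITIVE and satisfies the pointwise kernel bound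
`‖T(δ_b Z)(bd)‖ ≤ C·(L^{K−n})⁻¹^3·e^{−a·tdist(B^{K−n}(b), B^{K−n}(bd))}·‖Z‖` (`0 ≤ C`, `0 < a`), every `X` with `‖X b‖ ≤ s` has `‖(T X)(bd)‖ ≤ 3C(2(1+1∕a))³·s` — the row sum over the
`3·L^{3(K−n)}` fine bonds of each coarse block against `(L^{K−n})⁻³`, then the torus geometric series. [cite: Balaban1985BackgroundPropagators, (3.49) p.399, (3.11) p.392; Balaban1984PropagatorsII, (2.61) p.234] -/
theorem sup_row_of_kernel_row (T : (PBond (F.P K) 0 → Matrix (Fin 2) (Fin 2) ℂ) →+ (PBond (F.P K) 0 → Matrix (Fin 2) (Fin 2) ℂ)) {C a : ℝ} (hC : 0 ≤ C) (ha : 0 < a)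
    (hT : ∀ (b : PBond (F.P K) 0) (Z : Matrix (Fin 2) (Fin 2) ℂ) (bd : PBond (F.P K) 0),
      ‖T (Pi.single b Z) bd‖ ≤ C * ((F.L : ℝ) ^ (K - n))⁻¹ ^ 3 * Real.exp (-(a * (Site.tdist (iterBlockOf (K - n) b.src) (iterBlockOf (K - n) bd.src) : ℝ))) * ‖Z‖)
    (X : PBond (F.P K) 0 → Matrix (Fin 2) (Fin 2) ℂ) {s : ℝ} (hX : ∀ b, ‖X b‖ ≤ s) (bd : PBond (F.P K) 0) :
    ‖T X bd‖ ≤ 3 * C * (2 * (1 + 1 / a)) ^ 3 * s := by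
  classical
  have hs : 0 ≤ s := (norm_nonneg _).trans (hX bd)
  have hL : 0 < ((F.L : ℝ) ^ (K - n)) := by
    have : 0 < (F.L : ℝ) := by have := F.hL.2; exact_mod_cast (by omega : 0 < F.L)
    positivity
  -- linearity: `X = Σ_b δ_b · X b`
  have hX' : T X bd = ∑ b : PBond (F.P K) 0, T (Pi.single b (X b)) bd := by
    conv_lhs => rw [← Finset.univ_sum_single X]
    rw [map_sum, Finset.sum_apply]
  rw [hX']
  refine (norm_sum_le _ _).trans ?_
  -- each entry against the kernel bound, `‖X b‖ ≤ s`
  have hterm : ∀ b : PBond (F.P K) 0, ‖T (Pi.single b (X b)) bd‖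
      ≤ (C * ((F.L : ℝ) ^ (K - n))⁻¹ ^ 3 * s) * Real.exp (-(a * (Site.tdist (iterBlockOf (K - n) b.src) (iterBlockOf (K - n) bd.src) : ℝ))) := by
    intro b
    refine (hT b (X b) bd).trans ?_
    have he : 0 ≤ Real.exp (-(a * (Site.tdist (iterBlockOf (K - n) b.src) (iterBlockOf (K - n) bd.src) : ℝ))) := (Real.exp_pos _).le
    have h1 : C * ((F.L : ℝ) ^ (K - n))⁻¹ ^ 3 * Real.exp (-(a * (Site.tdist (iterBlockOf (K - n) b.src) (iterBlockOf (K - n) bd.src) : ℝ))) * ‖X b‖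
        ≤ C * ((F.L : ℝ) ^ (K - n))⁻¹ ^ 3 * Real.exp (-(a * (Site.tdist (iterBlockOf (K - n) b.src) (iterBlockOf (K - n) bd.src) : ℝ))) * s :=
      mul_le_mul_of_nonneg_left (hX b) (by positivity)
    linarith [h1]
  refine (Finset.sum_le_sum fun b _ => hterm b).trans ?_
  rw [← Finset.mul_sum]
  have hsum := sum_pbond_exp_neg_tdist_block_le F n K (iterBlockOf (K - n) bd.src) ha
  have hcoef : 0 ≤ C * ((F.L : ℝ) ^ (K - n))⁻¹ ^ 3 * s := by positivity
  calc C * ((F.L : ℝ) ^ (K - n))⁻¹ ^ 3 * s * ∑ b : PBond (F.P K) 0, Real.exp (-(a * (Site.tdist (iterBlockOf (K - n) b.src) (iterBlockOf (K - n) bd.src) : ℝ)))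
      ≤ C * ((F.L : ℝ) ^ (K - n))⁻¹ ^ 3 * s * (3 * (2 * (1 + 1 / a)) ^ 3 * ((F.L : ℝ) ^ (K - n)) ^ 3) := mul_le_mul_of_nonneg_left hsum hcoef
    _ = 3 * C * (2 * (1 + 1 / a)) ^ 3 * s := by
        field_simp

end Schur

/-! ## §2 The door at the EX display's letters -/

section Family

/-- ★ The door's `k349` is non-negative (the display's `hk` conjunct `0 ≤ k349 L` at this letter). [folklore] -/
theorem k349_nonneg (C349 δ349 : ℕ → ℝ) (hC349 : ∀ L, 1 < L → 0 ≤ C349 L) (hδ349 : ∀ L, 1 < L → 0 < δ349 L) :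
    ∀ L, 1 < L → 0 ≤ 3 * C349 L * (2 * (1 + 1 / δ349 L)) ^ 3 := by
  intro L hL
  have := hC349 L hL
  have := hδ349 L hL
  positivity

/-- ★★★ **DOOR «OPROW-349»: S22ᴸ's DISPLAYED OPERATOR ROW `hOp349` («`DPD*` is a bounded operator», sup→sup, `P = 1 − R_S`) FROM PRINT'S POINTWISE KERNEL ROW (3.49)** — at the member letters
(`T X := toL2⁻¹(DL2 U₀ (DstarL2 U₀ (toL2 X) − R_S U₀ (DstarL2 U₀ (toL2 X))))`), the displayed-to-be row `h349` «`‖T(δ_b Z)(bd)‖ ≤ C349(L)·(L^{K−n})⁻³·e^{−δ349(L)·d(B^{K−n}(b), B^{K−n}(bd))}·‖Z‖`»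
((3.49) with the level factors `= 1` at the one-level member and print's `η^d`-kernel convention (3.11); `d` = the coarse-block ℓ¹ torus distance) gives `hOp349` VERBATIM with
`k349 L := 3·C349 L·(2(1 + 1∕δ349 L))³`. [cite: Balaban1985BackgroundPropagators, (3.49) p.399, (3.11) p.392, (3.25)–(3.26) pp.394–395; Balaban1985Variational, p.299] -/
theorem hOp349_of_kernel349_family
    (α : ℕ → ℝ) (c₀ cB : ℕ → ℝ) [hc₀ : ∀ L : ℕ, Fact (0 < c₀ L)]
    (C349 δ349 : ℕ → ℝ) (hC349 : ∀ L, 1 < L → 0 ≤ C349 L) (hδ349 : ∀ L, 1 < L → 0 < δ349 L)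
    (h349 : ∀ (L : ℕ), 1 < L → ∀ (i : Idx L) (U₀ : GaugeField (i.1.1.P i.1.2.2) 0 (Matrix.specialUnitaryGroup (Fin 2) ℂ)), RegPr i.1.1 i.1.2.1 i.1.2.2 (α L) U₀ →
      ∀ (b : PBond (i.1.1.P i.1.2.2) 0) (Z : Matrix (Fin 2) (Fin 2) ℂ) (bd : PBond (i.1.1.P i.1.2.2) 0),
        ‖(toL2 i.1.1 i.1.2.2 (c₀ L)).symm (DL2 i.1.1 i.1.2.1 i.1.2.2 (c₀ L) U₀ (DstarL2 i.1.1 i.1.2.1 i.1.2.2 (c₀ L) U₀ (toL2 i.1.1 i.1.2.2 (c₀ L) (Pi.single b Z)) - RS i.1.1 i.1.2.1 i.1.2.2 i.2.2.le (c₀ L) (cB L) U₀ (DstarL2 i.1.1 i.1.2.1 i.1.2.2 (c₀ L) U₀ (toL2 i.1.1 i.1.2.2 (c₀ L) (Pi.single b Z))))) bd‖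
          ≤ C349 L * ((L : ℝ) ^ (i.1.2.2 - i.1.2.1))⁻¹ ^ 3 * Real.exp (-(δ349 L * (Site.tdist (iterBlockOf (i.1.2.2 - i.1.2.1) b.src) (iterBlockOf (i.1.2.2 - i.1.2.1) bd.src) : ℝ))) * ‖Z‖) :
    ∀ (L : ℕ), 1 < L → ∀ (i : Idx L) (U₀ : GaugeField (i.1.1.P i.1.2.2) 0 (Matrix.specialUnitaryGroup (Fin 2) ℂ)), RegPr i.1.1 i.1.2.1 i.1.2.2 (α L) U₀ →
      ∀ (X : PBond (i.1.1.P i.1.2.2) 0 → Matrix (Fin 2) (Fin 2) ℂ) (s : ℝ), (∀ bd, ‖X bd‖ ≤ s) → ∀ bd : PBond (i.1.1.P i.1.2.2) 0,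
        ‖(toL2 i.1.1 i.1.2.2 (c₀ L)).symm (DL2 i.1.1 i.1.2.1 i.1.2.2 (c₀ L) U₀ (DstarL2 i.1.1 i.1.2.1 i.1.2.2 (c₀ L) U₀ (toL2 i.1.1 i.1.2.2 (c₀ L) X) - RS i.1.1 i.1.2.1 i.1.2.2 i.2.2.le (c₀ L) (cB L) U₀ (DstarL2 i.1.1 i.1.2.1 i.1.2.2 (c₀ L) U₀ (toL2 i.1.1 i.1.2.2 (c₀ L) X)))) bd‖ ≤ (3 * C349 L * (2 * (1 + 1 / δ349 L)) ^ 3) * s := by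
  intro L hL i U₀ hreg X s hX bd
  have hFL' : (i.1.1.L : ℝ) = (L : ℝ) := by rw [i.2.1]
  -- the operator `X ↦ toL2⁻¹(D(1 − R_S)D* toL2 X)` as an additive map
  let Tlin : (PBond (i.1.1.P i.1.2.2) 0 → Matrix (Fin 2) (Fin 2) ℂ) →ₗ[ℂ] (PBond (i.1.1.P i.1.2.2) 0 → Matrix (Fin 2) (Fin 2) ℂ) :=
    (toL2 i.1.1 i.1.2.2 (c₀ L)).symm.toLinearMap ∘ₗ
      ((DL2 i.1.1 i.1.2.1 i.1.2.2 (c₀ L) U₀ ∘ₗ (DstarL2 i.1.1 i.1.2.1 i.1.2.2 (c₀ L) U₀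
          - RS i.1.1 i.1.2.1 i.1.2.2 i.2.2.le (c₀ L) (cB L) U₀ ∘ₗ DstarL2 i.1.1 i.1.2.1 i.1.2.2 (c₀ L) U₀)) ∘ₗ (toL2 i.1.1 i.1.2.2 (c₀ L)).toLinearMap)
  have hTlin : ∀ Y : PBond (i.1.1.P i.1.2.2) 0 → Matrix (Fin 2) (Fin 2) ℂ, Tlin Y
      = (toL2 i.1.1 i.1.2.2 (c₀ L)).symm (DL2 i.1.1 i.1.2.1 i.1.2.2 (c₀ L) U₀ (DstarL2 i.1.1 i.1.2.1 i.1.2.2 (c₀ L) U₀ (toL2 i.1.1 i.1.2.2 (c₀ L) Y) - RS i.1.1 i.1.2.1 i.1.2.2 i.2.2.le (c₀ L) (cB L) U₀ (DstarL2 i.1.1 i.1.2.1 i.1.2.2 (c₀ L) U₀ (toL2 i.1.1 i.1.2.2 (c₀ L) Y)))) := by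
    intro Y
    simp only [Tlin, LinearMap.coe_comp, Function.comp_apply, LinearEquiv.coe_toLinearMap, LinearMap.sub_apply, map_sub]
  have h := sup_row_of_kernel_row (F := i.1.1) (n := i.1.2.1) (K := i.1.2.2) Tlin.toAddMonoidHom (hC349 L hL) (hδ349 L hL)
    (fun b Z bd' => by
      rw [LinearMap.toAddMonoidHom_coe, hTlin, hFL']
      exact h349 L hL i U₀ hreg b Z bd') X hX bd
  rw [LinearMap.toAddMonoidHom_coe, hTlin] at h
  exact h

end Family

end Summit.QuantumFields.YangMills.Theorems.Prop7Op349OfKernelRow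

end
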